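import Mathlib
import HarnessLib

/-!
# Barrier: no componentwise comparison principle for coupled (non-quasimonotone) first-order systems

Catalogue entry (kind (c), method-level lemma; cell ns-claims, D-0090; technique rows T2/T7 «abstract
comparison / Perron (sub- and supersolution) arguments transplanted to systems»), salvage seat
ns-claims-salvage-p1.

A comparison principle «subsolution ≤ supersolution componentwise» (and with it Perron's envelope method
and sub/super-solution sandwich bounds) holds for a first-order system only under a sign structure on the
coupling — quasimonotonicity (Müller 1926, Kamke 1932) [cite: Walter1970DiffIntInequalities, Ch. II §12];
for a genuinely coupled SYMMETRIC HYPERBOLIC system it fails already for the linear `2 × 2` wave system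
`∂ₜu₁ + ∂ₓu₂ = 0`, `∂ₜu₂ + ∂ₓu₁ = 0` (constant coefficients, `A⁰ = I`, `A¹ = [[0,1],[1,0]]` symmetric):
d'Alembert's solution from the componentwise NONNEGATIVE datum `(φ, 0)`, `φ(x) = e^{−x²}`, is
`u₁ = (φ(x−t) + φ(x+t))/2`, `u₂ = (φ(x−t) − φ(x+t))/2`, and `u₂(1, −1) = (e^{−4} − 1)/2 < 0` — the solution
and the zero solution have ordered data and are not ordered. Kernel content (all PROVED, no named fact):
`dAlembert_solves` (the pair solves the system classically), `datum_nonneg`, `u₂_neg`.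

Adjudicated instance (cell record): claim C06 `Smith2006` (arXiv math/0609740 v4; withdrawn v5) —
ADJUDICATED #14 (ns-claims-lead-1 g2, 2026-08-26T22:00:07Z): first failing step
`Literature.Claims.NS.Smith2006.Theorem2Barriers` (Thm 2 (1)–(4) pp. 3–4, class unfilled gap: λ-uniform
`H^{2,2}` sub/supersolution barriers imported from the unheld [Sm2] Thms 15, 20 + errata [Sm4]; kernel
erratum evidence `….Theorems.Smith2006.not_Theorem2Barriers` p467801, refuter-3), load-bearing
`Theorem4Bounds` (λ-uniform sup bounds from the barriers by the imported comparison principle [Sm3] Thm 4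
p. 10, `theorem4Bounds_of_barriers'_comparison`), downstream kernel target `not_ComparisonAuxClassical`
(refuter-3, the 13-component instance). This entry is the METHOD-level statement behind that downstream
target: the order structure the chain needs is absent for non-diagonal symmetric hyperbolic systems
[cite: Smith2006, Thm 2 pp.3–4 and Thm 4 p.4] [cite: Smith2006PerronGeneral, Thm 1 p.2 and Thm 4 p.10].

WHAT THIS IS NOT: not a claim about NS regularity or blow-up; not a claim about any author beyond the
typed locator.
-/

noncomputable section

open Real Set

namespace Literature.Barriers.NavierStokesRegularity

namespace HyperbolicSystemNoComparison

/-- The datum profile `φ(x) = e^{−x²}` (positive). [folklore] -/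
def phi (x : ℝ) : ℝ := exp (-x ^ 2)

/-- d'Alembert component `u₁(t,x) = (φ(x−t) + φ(x+t))/2`. [folklore] -/
def u1 (t x : ℝ) : ℝ := (phi (x - t) + phi (x + t)) / 2

/-- d'Alembert component `u₂(t,x) = (φ(x−t) − φ(x+t))/2`. [folklore] -/
def u2 (t x : ℝ) : ℝ := (phi (x - t) - phi (x + t)) / 2

/-- The derivative profile `φ'(y) = −2y e^{−y²}`. [folklore] -/
def dphi (y : ℝ) : ℝ := -(2 * y) * exp (-y ^ 2)

/-- `φ' = dphi`. [cite: Walter1970DiffIntInequalities, Ch. IV §32] -/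
theorem hasDerivAt_phi (y : ℝ) : HasDerivAt phi (dphi y) y := by
  have h1 : HasDerivAt (fun x : ℝ => -x ^ 2) (-(2 * y)) y := by
    have h0 : HasDerivAt (fun x : ℝ => x ^ 2) (2 * y) y := by
      simpa using hasDerivAt_pow 2 y
    exact h0.neg
  have h2 := h1.exp
  have h3 : HasDerivAt (fun x : ℝ => exp (-x ^ 2)) (exp (-y ^ 2) * -(2 * y)) y := h2
  unfold dphi
  rw [show -(2 * y) * exp (-y ^ 2) = exp (-y ^ 2) * -(2 * y) from mul_comm _ _]
  exact h3

/-- Time derivative of `u₁`: `∂ₜu₁(t,x) = (−φ'(x−t) + φ'(x+t))/2`. [cite: Walter1970DiffIntInequalities, Ch. IV §32] -/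
theorem hasDerivAt_u1_t (t x : ℝ) :
    HasDerivAt (fun s => u1 s x) ((-dphi (x - t) + dphi (x + t)) / 2) t := by
  have ha : HasDerivAt (fun s => phi (x - s)) (-dphi (x - t)) t :=
    (hasDerivAt_phi (x - t)).comp_const_sub x t
  have hb : HasDerivAt (fun s => phi (x + s)) (dphi (x + t)) t :=
    (hasDerivAt_phi (x + t)).comp_const_add x t
  exact (ha.add hb).div_const 2

/-- Space derivative of `u₂`: `∂ₓu₂(t,x) = (φ'(x−t) − φ'(x+t))/2`. [cite: Walter1970DiffIntInequalities, Ch. IV §32] -/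
theorem hasDerivAt_u2_x (t x : ℝ) :
    HasDerivAt (fun y => u2 t y) ((dphi (x - t) - dphi (x + t)) / 2) x := by
  have ha : HasDerivAt (fun y => phi (y - t)) (dphi (x - t)) x :=
    (hasDerivAt_phi (x - t)).comp_sub_const x t
  have hb : HasDerivAt (fun y => phi (y + t)) (dphi (x + t)) x :=
    (hasDerivAt_phi (x + t)).comp_add_const x t
  exact (ha.sub hb).div_const 2

/-- Time derivative of `u₂`: `∂ₜu₂(t,x) = (−φ'(x−t) − φ'(x+t))/2`. [cite: Walter1970DiffIntInequalities, Ch. IV §32] -/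
theorem hasDerivAt_u2_t (t x : ℝ) :
    HasDerivAt (fun s => u2 s x) ((-dphi (x - t) - dphi (x + t)) / 2) t := by
  have ha : HasDerivAt (fun s => phi (x - s)) (-dphi (x - t)) t :=
    (hasDerivAt_phi (x - t)).comp_const_sub x t
  have hb : HasDerivAt (fun s => phi (x + s)) (dphi (x + t)) t :=
    (hasDerivAt_phi (x + t)).comp_const_add x t
  exact (ha.sub hb).div_const 2

/-- Space derivative of `u₁`: `∂ₓu₁(t,x) = (φ'(x−t) + φ'(x+t))/2`. [cite: Walter1970DiffIntInequalities, Ch. IV §32] -/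
theorem hasDerivAt_u1_x (t x : ℝ) :
    HasDerivAt (fun y => u1 t y) ((dphi (x - t) + dphi (x + t)) / 2) x := by
  have ha : HasDerivAt (fun y => phi (y - t)) (dphi (x - t)) x :=
    (hasDerivAt_phi (x - t)).comp_sub_const x t
  have hb : HasDerivAt (fun y => phi (y + t)) (dphi (x + t)) x :=
    (hasDerivAt_phi (x + t)).comp_add_const x t
  exact (ha.add hb).div_const 2

/-- **The d'Alembert pair solves the symmetric hyperbolic system** `∂ₜu₁ + ∂ₓu₂ = 0`, `∂ₜu₂ + ∂ₓu₁ = 0`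
classically at every `(t,x)`. [cite: Walter1970DiffIntInequalities, Ch. IV §32] -/
theorem dAlembert_solves (t x : ℝ) :
    deriv (fun s => u1 s x) t + deriv (fun y => u2 t y) x = 0 ∧
      deriv (fun s => u2 s x) t + deriv (fun y => u1 t y) x = 0 := by
  rw [(hasDerivAt_u1_t t x).deriv, (hasDerivAt_u2_x t x).deriv, (hasDerivAt_u2_t t x).deriv,
    (hasDerivAt_u1_x t x).deriv]
  constructor <;> ring

/-- The datum is componentwise nonnegative: `u₁(0,x) = φ(x) > 0`, `u₂(0,x) = 0` (so it lies above the
datum of the zero solution). [cite: Walter1970DiffIntInequalities, Ch. II §12] -/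
theorem datum_nonneg (x : ℝ) : 0 ≤ u1 0 x ∧ u2 0 x = 0 := by
  refine ⟨?_, ?_⟩
  · unfold u1 phi; positivity
  · unfold u2; simp

/-- **The order is not propagated**: `u₂(1, −1) = (e^{−4} − e^{0})/2 < 0` — comparison fails without
quasimonotonicity (Müller–Kamke). [cite: Walter1970DiffIntInequalities, Ch. II §12] -/
theorem u2_neg : u2 1 (-1) < 0 := by
  have hval : u2 1 (-1) = (exp (-4) - 1) / 2 := by
    unfold u2 phi; norm_num
  rw [hval]
  have h : exp (-4 : ℝ) < 1 := exp_lt_one_iff.2 (by norm_num)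
  linarith

end HyperbolicSystemNoComparison

open HyperbolicSystemNoComparison

/-- **Barrier (method-level lemma): coupled symmetric hyperbolic systems admit no componentwise
comparison principle.** For the linear wave system `∂ₜu₁ + ∂ₓu₂ = 0`, `∂ₜu₂ + ∂ₓu₁ = 0` there is a
classical solution whose datum is componentwise `≥ 0` (the datum of the solution `0`) but which is
negative somewhere at time `1`: sub- and supersolution ordering, Perron envelopes and sandwich bounds
between barriers are unavailable without a quasimonotone (cooperative / diagonal-transport) structure
[cite: Walter1970DiffIntInequalities, Ch. II §12 and Ch. IV §32].

BARRIER (structured block, D-0021):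
technique_class: comparison-principle perron-method sub-super-solutions viscosity-solutions-for-systems symmetric-hyperbolic-relaxation sandwich-bounds
blocks: regularity/global-existence arguments for NS (or a first-order hyperbolic relaxation / prolongation of it) that bound the solution between λ-uniform sub- and supersolutions via a componentwise comparison principle for a genuinely coupled first-order system; adjudicated instance C06 `Smith2006` — Thm 2 pp.3–4 (barriers, `Literature.Claims.NS.Smith2006.Theorem2Barriers`, ADJUDICATED #14: unfilled gap, kernel erratum `not_Theorem2Barriers` p467801) feeding Thm 4 p.4 (`Theorem4Bounds`) through the comparison principle of [Sm3] Thm 4 p.10 (`ComparisonAuxClassical`, refuter-3's downstream target) [cite: Smith2006, Thm 2 pp.3–4, Thm 4 p.4] [cite: Smith2006PerronGeneral, Thm 4 p.10].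
because: comparison for systems requires quasimonotonicity of the coupling (Müller–Kamke; necessary and sufficient) [cite: Walter1970DiffIntInequalities, Ch. II §12]; symmetric hyperbolic transport coupling `A¹ = [[0,1],[1,0]]` mixes characteristic variables `u₁ ± u₂` and destroys the order — kernel: `dAlembert_solves`, `datum_nonneg`, `u2_neg`.
evasions_known: diagonal (uncoupled-transport) systems with quasimonotone zeroth-order coupling DO have comparison ([Sm3] l.36–42 states its theorems for diagonal coefficient matrices) — the NS prolongation (6) is not diagonal [cite: Smith2006PerronGeneral, Thm 4 p.10]; scalar equations (maximum principle) — NS has no scalar reduction (pressure is non-local).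
scope_caveats: (i) the kernel instance is the `2 × 2` constant-coefficient wave system in one space dimension (embedded in any slab by ignoring the other variables); (ii) it refutes componentwise ORDER propagation, not existence; (iii) says nothing about NS blow-up or regularity.
status: established -/
def HyperbolicSystemNoComparison : Prop :=
  ∃ u₁ u₂ : ℝ → ℝ → ℝ,
    (∀ t x, deriv (fun s => u₁ s x) t + deriv (fun y => u₂ t y) x = 0 ∧
        deriv (fun s => u₂ s x) t + deriv (fun y => u₁ t y) x = 0) ∧
      (∀ x, 0 ≤ u₁ 0 x ∧ u₂ 0 x = 0) ∧ ∃ t x, 0 < t ∧ u₂ t x < 0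

/-- Discharge: the d'Alembert pair from the Gaussian datum. [cite: Walter1970DiffIntInequalities, Ch. IV §32] -/
theorem hyperbolicSystemNoComparison_holds : HyperbolicSystemNoComparison :=
  ⟨u1, u2, dAlembert_solves, datum_nonneg, 1, -1, one_pos, u2_neg⟩

end Literature.Barriers.NavierStokesRegularity

end
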